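import Mathlib
import HarnessLib
import HarnessLib.Audit
import Summits.ValiantsHypothesis.ValiantsHypothesis.Theorems.LacunarySymmetroidMatrixDescartesZeroChangeConcavityBudgetPureT5

/-!
# ValiantsHypothesis / LacunarySymmetroid — crux `MatrixDescartes` (stmt-ValiantsHypothesis-18050, V1), LINE (A) «product_plus_one»:
# the pure `(+,−,−)` core — the middle-letter sum DECREASES STRICTLY along the critical points of a window

Seventh part of the concavity budget (✓ `…ZeroChangeConcavityBudgetPureT5`).  The identity `(c−a)·M(t) = c·(m − Z₀(t))` at a critical point
off the roots (`middleSum_eq_of_critical`, the explicit form behind ✓ `middleSum_nonpos_iff_of_critical`) and the strict increase of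
`Z₀ = Σ_j a_{j0}/g_j` on root-free stretches of a pure `(+,−,−)` company (✓ `bottomSum_lt_of_rootFree`) give the (M,T)-plane picture of a window:

* ★ `pureT5_middleSum_strictAnti_of_critical` — for critical points `t₁ < t₂` with no root of the product on `[t₁, t₂]`:
  `M(t₂) < M(t₁)` (and, through `aM + cT = 0`, `T(t₂) > T(t₁)`): the critical points of a window, read left to right, march monotonically
  down the line `aM + cT = 0` from the quadrant `M > 0 > T` (middle letters win: strict local maxima) into `M < 0 < T` (top letters win: the
  bad block), never back — ✓ `pureT5_bad_after_bad` is the sign corollary.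

HONEST FRAMING: sector bookkeeping on the pure `(+,−,−)` class; def-free, no named facts, no sorry, standard axioms; closes NO stub by name;
`OneChangeFloorK3`, `MatrixDescartes` (stmt-ValiantsHypothesis-18050) OPEN; `VP ≠ VNP` is NOT proved and nothing here bears on it.

[folklore] Elementary; no citation needed.
-/

set_option linter.dupNamespace false

namespace Summit.ValiantsHypothesis.ValiantsHypothesis.Theorems.LacunarySymmetroidMatrixDescartes

namespace ZeroChange

open Polynomial Finset Filter Topology

/-- **`(c − a)·M = c·(m − Z₀)` at a critical point off the roots** (any company; from `Z₀ + M + T = m` and `aM + cT = 0`). -/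
theorem middleSum_eq_of_critical (m a c : ℕ) (co : Fin m → ℝ × ℝ × ℝ) {t : ℝ}
    (hΦ : (∏ j, row a c (co j).1 (co j).2.1 (co j).2.2).eval t ≠ 0)
    (hcrit : (derivative (∏ j, row a c (co j).1 (co j).2.1 (co j).2.2)).eval t = 0) :
    ((c : ℝ) - a) * middleSum a c co t =
      (c : ℝ) * ((m : ℝ) - ∑ j, (co j).1 / (row a c (co j).1 (co j).2.1 (co j).2.2).eval t) := by
  have hgt : ∀ j, (row a c (co j).1 (co j).2.1 (co j).2.2).eval t ≠ 0 := by
    intro j h0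
    apply hΦ
    rw [eval_prod]
    exact prod_eq_zero (mem_univ j) h0
  have htot := pick_sums_total m a c co hgt
  have hrel := critical_relation m a c co hΦ hcrit
  have hT' : ∑ j, (co j).2.2 * t ^ c / (row a c (co j).1 (co j).2.1 (co j).2.2).eval t =
      (m : ℝ) - ∑ j, (co j).1 / (row a c (co j).1 (co j).2.1 (co j).2.2).eval t - middleSum a c co t := by linarith
  rw [hT'] at hrel
  linarith

/-- ★ **`M` decreases strictly along the critical points of a window** (pure `(+,−,−)` company, `m ≥ 1`, `0 < a < c`): for critical points
`t₁ < t₂` with no root of the product on `[t₁, t₂] ⊂ (0,∞)`, `M(t₂) < M(t₁)`. -/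
theorem pureT5_middleSum_strictAnti_of_critical (m a c : ℕ) (hm : 0 < m) (ha : 0 < a) (hac : a < c)
    (co : Fin m → ℝ × ℝ × ℝ)
    (hT5 : ∀ j, 0 < (co j).1 ∧ (co j).2.1 ≤ 0 ∧ (co j).2.2 ≤ 0 ∧ ((co j).2.1 < 0 ∨ (co j).2.2 < 0))
    {t₁ t₂ : ℝ} (h1 : 0 < t₁) (h12 : t₁ < t₂)
    (hnoroot : ∀ z, t₁ ≤ z → z ≤ t₂ → (∏ j, row a c (co j).1 (co j).2.1 (co j).2.2).eval z ≠ 0)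
    (hcrit₁ : (derivative (∏ j, row a c (co j).1 (co j).2.1 (co j).2.2)).eval t₁ = 0)
    (hcrit₂ : (derivative (∏ j, row a c (co j).1 (co j).2.1 (co j).2.2)).eval t₂ = 0) :
    middleSum a c co t₂ < middleSum a c co t₁ := by
  have e1 := middleSum_eq_of_critical m a c co (hnoroot t₁ le_rfl h12.le) hcrit₁
  have e2 := middleSum_eq_of_critical m a c co (hnoroot t₂ h12.le le_rfl) hcrit₂
  have hmono := bottomSum_lt_of_rootFree m a c hm ha hac co hT5 h1 h12 hnoroot
  have hc' : (0 : ℝ) < c := by exact_mod_cast (ha.trans hac)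
  have hca : (0 : ℝ) < c - a := by
    have : (a : ℝ) < c := by exact_mod_cast hac
    linarith
  nlinarith [mul_lt_mul_of_pos_left hmono hc']

/-- **… and `T` increases strictly** along the same critical points (`aM + cT = 0` at each). -/
theorem pureT5_topSum_strictMono_of_critical (m a c : ℕ) (hm : 0 < m) (ha : 0 < a) (hac : a < c)
    (co : Fin m → ℝ × ℝ × ℝ)
    (hT5 : ∀ j, 0 < (co j).1 ∧ (co j).2.1 ≤ 0 ∧ (co j).2.2 ≤ 0 ∧ ((co j).2.1 < 0 ∨ (co j).2.2 < 0))
    {t₁ t₂ : ℝ} (h1 : 0 < t₁) (h12 : t₁ < t₂)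
    (hnoroot : ∀ z, t₁ ≤ z → z ≤ t₂ → (∏ j, row a c (co j).1 (co j).2.1 (co j).2.2).eval z ≠ 0)
    (hcrit₁ : (derivative (∏ j, row a c (co j).1 (co j).2.1 (co j).2.2)).eval t₁ = 0)
    (hcrit₂ : (derivative (∏ j, row a c (co j).1 (co j).2.1 (co j).2.2)).eval t₂ = 0) :
    ∑ j, (co j).2.2 * t₁ ^ c / (row a c (co j).1 (co j).2.1 (co j).2.2).eval t₁ <
      ∑ j, (co j).2.2 * t₂ ^ c / (row a c (co j).1 (co j).2.1 (co j).2.2).eval t₂ := by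
  have hM := pureT5_middleSum_strictAnti_of_critical m a c hm ha hac co hT5 h1 h12 hnoroot hcrit₁ hcrit₂
  have r1 := critical_relation m a c co (hnoroot t₁ le_rfl h12.le) hcrit₁
  have r2 := critical_relation m a c co (hnoroot t₂ h12.le le_rfl) hcrit₂
  have ha' : (0 : ℝ) < a := by exact_mod_cast ha
  have hc' : (0 : ℝ) < c := by exact_mod_cast (ha.trans hac)
  nlinarith [mul_lt_mul_of_pos_left hM ha']

end ZeroChange

end Summit.ValiantsHypothesis.ValiantsHypothesis.Theorems.LacunarySymmetroidMatrixDescartes
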